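import Summits.KontsevichZagierPeriods.KontsevichZagierPeriods.Theorems.VietaFibreKernelFormBumpBody
import Summits.KontsevichZagierPeriods.KontsevichZagierPeriods.Theorems.VietaFibreKernelFormNearOne
import Summits.KontsevichZagierPeriods.KontsevichZagierPeriods.Theorems.VietaFibreKernelFormWeakKernelNormalForm
import HarnessLib

/-!
# Crux `KernelForm` (stmt-KontsevichZagierPeriods-10447), line `Sketch`: the whole cut near the cube

Combining the bump-body normal form (`exists_bumpBody_sub_mem_relations`) with the near-one normal
form of the geometric half (`cancellation_iff_nearOne`: one may divide by `1 + v`, `‖v‖∞ ≤ θ < 1`),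
every object in the cut `KernelForm ↔ WeakKernel ∧ Cancellation` can be confined to an arbitrarily
thin neighbourhood of a unit cube. Write `U` for a closed unit cube, "body" for a compact
`ℚ`-semialgebraic domain with non-empty interior and integrand `1`, "`θ`-bump" for a body sandwiched
between the slabs `[0,1]^m × [0, 1 − θ]` and `[0,1]^m × [0, 1 + θ]`, and `A ~ B` for
`[A] − [B] ∈ KZ.relations`. For every fixed `0 < θ < 1`:

* `exists_bumpBody_of_cubeRep` — a unit-cube representation `[Q, v]` with `|v| ≤ θ` satisfies
  `[K] ≡ [Q, v] + [U]` for a `θ`-bump `K` (the closure of the region under `1 + v`);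
* `cancellation_iff_bumpBodyCancellation` — `Cancellation ⟺` for every unit-volume `θ`-bump `A`
  and every `θ`-bump stabiliser `K`: `K × A ~ K × U ⟹ A ~ U`;
* `weakKernel_iff_bumpStablyCube` — `WeakKernel ⟺` every unit-volume `θ`-bump `A` is stably
  cube-able (`∃` body `K`, `K × A ~ K × U`);
* `kernelForm_iff_bump` — the crux: cubing of unit-volume `θ`-bumps `⟺` their stable cubing `∧`
  cancellation of `θ`-bump stabilisers; OctahedralSymmetry twin.

So Conjecture 1 for this calculus is decided inside any `C⁰`-small neighbourhood of the cubes: both a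
would-be non-cube-able unit-volume body and a would-be non-cancelling stabiliser may be taken to be
gentle semialgebraic bumps on a cube (the bound `θ < 1` is sharp for the stabiliser, `not_nearOne_one`).

References: M. Kontsevich, D. Zagier, *Periods* (2001), §1.2, Problem 1; J. Cresson, J. Viu-Sos,
JTNB 34 (2022), §1, Problem 2.1; J. Viu-Sos, IJNT 17 (2021), Cor. 2.3.
-/

noncomputable section

open MeasureTheory Set
open Literature.NumberTheory.Transcendental

namespace Summit.KontsevichZagierPeriods.KernelForm.LocaliseAtValuePrime

/-- **A near-one cube representation is a bump body.** If `V` is a unit-cube representation of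
dimension `m` with `|v| ≤ θ < 1` on the cube, there are a `θ`-bump body `K` of dimension `m + 1` and
a unit-cube representation `U₀` of dimension `m` with `[K] − [V] − [U₀] ∈ relations`: `K` is the
closure of the region under the graph of `1 + v` (integrand additivity, one Newton–Leibniz move
`KZ.exists_underGraph`, closure `KZ.exists_closure_of_integrand_one`). [cite: ViuSos2021, Cor. 2.3]
[folklore] -/
theorem exists_bumpBody_of_cubeRep :
    ∀ {θ : ℝ}, θ < 1 → ∀ (m : ℕ) (V : KZ.IntegralRep m), V.domain = KZ.cube m →
      (∀ y ∈ V.domain, |V.integrand y| ≤ θ) →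
      ∃ (K : KZ.IntegralRep (m + 1)) (U₀ : KZ.IntegralRep m), IsCompact K.domain ∧
        (interior K.domain).Nonempty ∧ (∀ x ∈ K.domain, K.integrand x = 1) ∧
        U₀.domain = KZ.cube m ∧ (U₀.integrand = fun _ => 1) ∧
        {z | (Fin.init z : Fin m → ℝ) ∈ KZ.cube m ∧ 0 ≤ z (Fin.last m) ∧ z (Fin.last m) ≤ 1 - θ} ⊆
          K.domain ∧
        K.domain ⊆
          {z | (Fin.init z : Fin m → ℝ) ∈ KZ.cube m ∧ 0 ≤ z (Fin.last m) ∧ z (Fin.last m) ≤ 1 + θ} ∧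
        KZ.of K - KZ.of V - KZ.of U₀ ∈ KZ.relations := by
  intro θ hθ1 m V hVd hVb
  -- the unit cube `U₀` of dimension `m`
  obtain ⟨U₀, hU₀d, hU₀i⟩ := KZ.exists_oneRep (KZ.isSemialgebraic_cube (n := m))
    (by simp [KZ.volume_cube])
  have hU₀v : U₀.value = 1 := by
    rw [KZ.IntegralRep.value_eq_volume_real U₀ (fun x _ => by rw [hU₀i]), hU₀d, KZ.volume_real_cube]
  -- `H = [[0,1]^m, v + 1]`, and `[H] − [V] − [U₀] ∈ integrandAddRel`
  have hcube : Literature.ModelTheory.ExponentialFields.IsSemialgebraic ℚ (KZ.cube m) :=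
    KZ.isSemialgebraic_cube
  have hvsa : IsSemialgebraicFunOn ℚ (KZ.cube m) V.integrand := hVd ▸ V.isSemialgebraicFunOn_integrand
  have h1sa : IsSemialgebraicFunOn ℚ (KZ.cube m) fun _ => (1 : ℝ) := by
    simpa using isSemialgebraicFunOn_ratCast hcube 1
  have hHint : IntegrableOn (fun x => V.integrand x + 1) (KZ.cube m) :=
    (hVd ▸ V.integrableOn).add (integrableOn_const (by simp [KZ.volume_cube]))
  let H : KZ.IntegralRep m := ⟨KZ.cube m, fun x => V.integrand x + 1, hcube, hvsa.fun_add h1sa, hHint⟩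
  have r₂ : KZ.of H - KZ.of V - KZ.of U₀ ∈ KZ.relations := by
    refine KZ.integrandAddRel_subset_relations ⟨m, H, V, U₀, hVd, hU₀d, fun x _ => ?_, rfl⟩
    simp [H, hU₀i]
  have hH0 : ∀ x ∈ H.domain, 0 ≤ H.integrand x := by
    intro x hx
    have hb := abs_le.mp (hVb x (by simpa [hVd] using hx))
    change 0 ≤ V.integrand x + 1
    linarith [hb.1]
  have hHle : ∀ x ∈ H.domain, H.integrand x ≤ 1 + θ := by
    intro x hx
    have hb := abs_le.mp (hVb x (by simpa [hVd] using hx))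
    change V.integrand x + 1 ≤ 1 + θ
    linarith [hb.2]
  have hHge : ∀ x ∈ H.domain, 1 - θ ≤ H.integrand x := by
    intro x hx
    have hb := abs_le.mp (hVb x (by simpa [hVd] using hx))
    change 1 - θ ≤ V.integrand x + 1
    linarith [hb.1]
  have hθ2 : θ < 2 := by linarith
  -- the region under the graph `G`, one Newton–Leibniz move away
  obtain ⟨G, hGd, hGi, hGH⟩ := KZ.exists_underGraph H hH0
  have r₃ : KZ.of G - KZ.of H ∈ KZ.relations := KZ.newtonLeibnizRel_subset_relations hGH
  have hG1 : ∀ x ∈ G.domain, G.integrand x = 1 := fun x _ => by rw [hGi]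
  have hGsub : G.domain ⊆
      {z | (Fin.init z : Fin m → ℝ) ∈ KZ.cube m ∧ 0 ≤ z (Fin.last m) ∧ z (Fin.last m) ≤ 1 + θ} := by
    intro z hz
    rw [hGd, KZlog.mem_band] at hz
    exact ⟨hz.1, hz.2.1, hz.2.2.trans (hHle _ hz.1)⟩
  have hGb : Bornology.IsBounded G.domain := by
    refine (Metric.isBounded_Icc (0 : Fin (m + 1) → ℝ) (fun _ => 3)).subset fun z hz => ?_
    obtain ⟨hinit, h0, h1⟩ := hGsub hz
    rw [KZ.mem_cube] at hinit
    refine ⟨fun i => ?_, fun i => ?_⟩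
    · refine Fin.lastCases ?_ (fun j => ?_) i
      · exact h0
      · exact (hinit j).1
    · refine Fin.lastCases ?_ (fun j => ?_) i
      · change z (Fin.last m) ≤ 3
        linarith
      · change z (Fin.castSucc j) ≤ 3
        have := (hinit j).2
        change z (Fin.castSucc j) ≤ 1 at this
        linarith
  -- `vol G > 0`: it contains the slab of height `1 − θ > 0` over the cube
  have hGv : G.value = V.value + 1 := by
    have h₂ := eval_eq_zero_of_mem r₂
    have h₃ := eval_eq_zero_of_mem r₃
    simp only [map_sub, KZ.eval_of, hU₀v] at h₂ h₃
    linarith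
  have hVv : |V.value| ≤ θ := abs_value_le_of_cube V hVd hVb
  have hGvol : 0 < volume G.domain := by
    have h := G.value_eq_volume_real hG1
    have hpos : 0 < G.value := by
      rw [hGv]
      have := (abs_le.mp hVv).1
      linarith
    rw [h, measureReal_def] at hpos
    exact pos_iff_ne_zero.mpr fun h0 => by simp [h0] at hpos
  -- the body `K = closure G`
  obtain ⟨K, hKd, hKi, hKc, hKint, r₄⟩ := KZ.exists_closure_of_integrand_one G hG1 hGb
  refine ⟨K, U₀, hKc, hKint hGvol, fun x _ => by rw [hKi], hU₀d, hU₀i, ?_, ?_, ?_⟩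
  · rw [hKd]
    refine Subset.trans (fun z hz => ?_) subset_closure
    obtain ⟨hinit, h0, h1⟩ := hz
    rw [hGd, KZlog.mem_band]
    exact ⟨hinit, h0, h1.trans (hHge _ hinit)⟩
  · rw [hKd]
    refine closure_minimal hGsub ?_
    have hc1 : IsClosed {z : Fin (m + 1) → ℝ | (Fin.init z : Fin m → ℝ) ∈ KZ.cube m} :=
      KZ.isClosed_cube.preimage (continuous_pi fun i => continuous_apply _)
    have hc2 : IsClosed {z : Fin (m + 1) → ℝ | 0 ≤ z (Fin.last m)} :=
      isClosed_le continuous_const (continuous_apply _)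
    have hc3 : IsClosed {z : Fin (m + 1) → ℝ | z (Fin.last m) ≤ 1 + θ} :=
      isClosed_le (continuous_apply _) continuous_const
    convert (hc1.inter hc2).inter hc3 using 1
    ext z
    simp only [mem_setOf_eq, mem_inter_iff, and_assoc]
  · have : KZ.of K - KZ.of V - KZ.of U₀ =
        (KZ.of H - KZ.of V - KZ.of U₀) + (KZ.of G - KZ.of H) - (KZ.of G - KZ.of K) := by abel
    rw [this]
    exact KZ.relations.sub_mem (KZ.relations.add_mem r₂ r₃) r₄

/-- **Cancellation ⟺ bump stabilisers cancel on bumps.** For every fixed `0 < θ < 1`: multipliers of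
non-zero value are non-zero-divisors modulo the moves iff for every unit-volume `θ`-bump body `A`
(with `U` the unit cube of its dimension) and every `θ`-bump body `K`: `K × A ~ K × U ⟹ A ~ U`.
(`→`: `[K]` has value `vol K > 0`; `←`: by the near-one normal form `cancellation_iff_nearOne` it
suffices to cancel `1 + [V]` (`V` a cube representation, `|v| ≤ θ`) on a cube representation `[W]`
of value `0`; put `[W] ≡ [A] − [U]` in bump-body normal form and `[U₀] + [V] ≡ [K]` by
`exists_bumpBody_of_cubeRep`.) [folklore] -/
theorem cancellation_iff_bumpBodyCancellation :
    ∀ θ : ℝ, 0 < θ → θ < 1 →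
      ((∀ c s : KZ.FormalRep, KZ.eval s ≠ 0 → s * c ∈ KZ.relations → c ∈ KZ.relations) ↔
        ∀ (k m : ℕ) (A U : KZ.IntegralRep (k + 1)) (K : KZ.IntegralRep (m + 1)), IsCompact A.domain →
          (interior A.domain).Nonempty → (∀ x ∈ A.domain, A.integrand x = 1) → A.value = 1 →
          {z | (Fin.init z : Fin k → ℝ) ∈ KZ.cube k ∧ 0 ≤ z (Fin.last k) ∧ z (Fin.last k) ≤ 1 - θ} ⊆
            A.domain →
          A.domain ⊆
            {z | (Fin.init z : Fin k → ℝ) ∈ KZ.cube k ∧ 0 ≤ z (Fin.last k) ∧ z (Fin.last k) ≤ 1 + θ} →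
          U.domain = KZ.cube (k + 1) → (U.integrand = fun _ => 1) →
          IsCompact K.domain → (interior K.domain).Nonempty → (∀ x ∈ K.domain, K.integrand x = 1) →
          {z | (Fin.init z : Fin m → ℝ) ∈ KZ.cube m ∧ 0 ≤ z (Fin.last m) ∧ z (Fin.last m) ≤ 1 - θ} ⊆
            K.domain →
          K.domain ⊆
            {z | (Fin.init z : Fin m → ℝ) ∈ KZ.cube m ∧ 0 ≤ z (Fin.last m) ∧ z (Fin.last m) ≤ 1 + θ} →
          KZ.of (K.prod A) - KZ.of (K.prod U) ∈ KZ.relations → KZ.of A - KZ.of U ∈ KZ.relations) := by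
  intro θ hθ0 hθ1
  constructor
  · intro hC k m A U K _ _ _ _ _ _ _ _ hKc hKi hK1 _ _ hK
    refine hC _ (KZ.of K) (eval_of_pos_of_isCompact_of_interior_nonempty K hKc hKi hK1).ne' ?_
    rwa [mul_sub, KZ.of_mul_of, KZ.of_mul_of]
  · intro h
    rw [cancellation_iff_nearOne θ hθ0 hθ1]
    intro m k W V hWd hVd hVb hWV
    -- `[W]` has value `0`
    have hVv : |V.value| ≤ θ := abs_value_le_of_cube V hVd hVb
    have hWv : KZ.eval (KZ.of W) = 0 := by
      have h0 := eval_eq_zero_of_mem hWV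
      rw [map_add, KZ.eval_mul', KZ.eval_of, KZ.eval_of] at h0
      have h1 : W.value * (1 + V.value) = 0 := by linear_combination h0
      rcases mul_eq_zero.mp h1 with h1 | h1
      · rw [KZ.eval_of]; exact h1
      · exfalso
        have := (abs_le.mp hVv).1
        linarith
    -- bump-body normal form `[W] ≡ [A] − [U]`
    obtain ⟨k₁, A, U, hAc, hAi, hA1, hAv, hUd, hUi, hAlo, hAhi, e⟩ :=
      exists_bumpBody_sub_mem_relations (KZ.of W) hWv hθ0 hθ1
    -- bump stabiliser `[K] ≡ [V] + [U₀]`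
    obtain ⟨K, U₀, hKc, hKi, hK1, hU₀d, hU₀i, hKlo, hKhi, eK⟩ :=
      exists_bumpBody_of_cubeRep hθ1 k V hVd hVb
    -- `[K] * [W] ∈ relations`
    have hU₀W : KZ.of U₀ * KZ.of W - KZ.of W ∈ KZ.relations := by
      have e' : KZ.of U₀ * KZ.of W - KZ.of W =
          (KZ.of U₀ * KZ.of W - KZ.of W * KZ.of U₀) + (KZ.of W * KZ.of U₀ - KZ.of W) := by abel
      rw [e']
      exact KZ.relations.add_mem (KZ.mul_sub_mul_comm_mem_relations _ _)
        (stub_cubeMul k U₀ (KZ.of W) hU₀d hU₀i)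
    have hKW : KZ.of K * KZ.of W ∈ KZ.relations := by
      have e' : KZ.of K * KZ.of W = (KZ.of K - KZ.of V - KZ.of U₀) * KZ.of W +
          (KZ.of W + KZ.of V * KZ.of W) + (KZ.of U₀ * KZ.of W - KZ.of W) := by
        rw [sub_mul, sub_mul]; abel
      rw [e']
      exact KZ.relations.add_mem (KZ.relations.add_mem
        (KZ.mul_mem_relations_right_holds _ _ eK) hWV) hU₀W
    -- hence `K × A ~ K × U`, hence `A ~ U`, hence `[W] ∈ relations`
    have hKAU : KZ.of (K.prod A) - KZ.of (K.prod U) ∈ KZ.relations := by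
      have e' : KZ.of (K.prod A) - KZ.of (K.prod U) =
          KZ.of K * KZ.of W - KZ.of K * (KZ.of W - (KZ.of A - KZ.of U)) := by
        rw [← KZ.of_mul_of, ← KZ.of_mul_of, mul_sub, mul_sub]; abel
      rw [e']
      exact KZ.relations.sub_mem hKW (KZ.mul_mem_relations_left_holds _ _ e)
    have hAU := h k₁ k A U K hAc hAi hA1 hAv hAlo hAhi hUd hUi hKc hKi hK1 hKlo hKhi hKAU
    have e' : KZ.of W = (KZ.of W - (KZ.of A - KZ.of U)) + (KZ.of A - KZ.of U) := by abel
    rw [e']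
    exact KZ.relations.add_mem e hAU

/-- **Weak kernel ⟺ stable cubing of bumps.** For every fixed `0 < θ < 1`: every formal combination
of value `0` admits a canceller of non-zero value iff every unit-volume `θ`-bump body `A` is stably
cube-able: there is a body `K` (any dimension) with `K × A ~ K × U`. (`→`: the compact-canceller
form of the weak kernel applied to `[A] − [U]`; `←`: bump-body normal form, `[K]` is a canceller of
value `vol K > 0`.) [folklore] -/
theorem weakKernel_iff_bumpStablyCube :
    ∀ θ : ℝ, 0 < θ → θ < 1 →
      ((∀ c : KZ.FormalRep, KZ.eval c = 0 → ∃ s : KZ.FormalRep, KZ.eval s ≠ 0 ∧ s * c ∈ KZ.relations) ↔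
        ∀ (k : ℕ) (A U : KZ.IntegralRep (k + 1)), IsCompact A.domain → (interior A.domain).Nonempty →
          (∀ x ∈ A.domain, A.integrand x = 1) → A.value = 1 →
          {z | (Fin.init z : Fin k → ℝ) ∈ KZ.cube k ∧ 0 ≤ z (Fin.last k) ∧ z (Fin.last k) ≤ 1 - θ} ⊆
            A.domain →
          A.domain ⊆
            {z | (Fin.init z : Fin k → ℝ) ∈ KZ.cube k ∧ 0 ≤ z (Fin.last k) ∧ z (Fin.last k) ≤ 1 + θ} →
          U.domain = KZ.cube (k + 1) → (U.integrand = fun _ => 1) →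
          ∃ (m : ℕ) (K : KZ.IntegralRep (m + 1)), IsCompact K.domain ∧ (interior K.domain).Nonempty ∧
            (∀ x ∈ K.domain, K.integrand x = 1) ∧
            KZ.of (K.prod A) - KZ.of (K.prod U) ∈ KZ.relations) := by
  intro θ hθ0 hθ1
  rw [weakKernel_iff_exists_compact]
  constructor
  · intro hW k A U _ _ _ hAv _ _ hUd hUi
    have hUv : U.value = 1 := by
      rw [KZ.IntegralRep.value_eq_volume_real U (fun x _ => by rw [hUi]), hUd, KZ.volume_real_cube]
    have hc : KZ.eval (KZ.of A - KZ.of U) = 0 := by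
      rw [map_sub, KZ.eval_of, KZ.eval_of, hAv, hUv, sub_self]
    obtain ⟨m, K, hKc, hKi, hK1, hK⟩ := hW _ hc
    refine ⟨m, K, hKc, hKi, hK1, ?_⟩
    rwa [mul_sub, KZ.of_mul_of, KZ.of_mul_of] at hK
  · intro h c hc
    obtain ⟨k, A, U, hAc, hAi, hA1, hAv, hUd, hUi, hAlo, hAhi, e⟩ :=
      exists_bumpBody_sub_mem_relations c hc hθ0 hθ1
    obtain ⟨m, K, hKc, hKi, hK1, hK⟩ := h k A U hAc hAi hA1 hAv hAlo hAhi hUd hUi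
    refine ⟨m, K, hKc, hKi, hK1, ?_⟩
    have e' : KZ.of K * c =
        KZ.of K * (c - (KZ.of A - KZ.of U)) + (KZ.of (K.prod A) - KZ.of (K.prod U)) := by
      rw [← KZ.of_mul_of, ← KZ.of_mul_of, mul_sub, mul_sub]; abel
    rw [e']
    exact KZ.relations.add_mem (KZ.mul_mem_relations_left_holds _ _ e) hK

/-- **The crux near the cube.** For every fixed `0 < θ < 1`: the kernel form of Conjecture 1 holds
iff (i) every unit-volume `θ`-bump body is stably cube-able and (ii) `θ`-bump stabilisers cancel on
unit-volume `θ`-bump bodies — the cut `KernelForm ↔ WeakKernel ∧ Cancellation` with every object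
confined to the `θ`-neighbourhood of a unit cube. [folklore] -/
theorem kernelForm_iff_bump :
    ∀ θ : ℝ, 0 < θ → θ < 1 →
      (Summit.KontsevichZagierPeriods.KontsevichZagierPeriods.Theses.VietaFibre.KernelForm ↔
        (∀ (k : ℕ) (A U : KZ.IntegralRep (k + 1)), IsCompact A.domain → (interior A.domain).Nonempty →
          (∀ x ∈ A.domain, A.integrand x = 1) → A.value = 1 →
          {z | (Fin.init z : Fin k → ℝ) ∈ KZ.cube k ∧ 0 ≤ z (Fin.last k) ∧ z (Fin.last k) ≤ 1 - θ} ⊆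
            A.domain →
          A.domain ⊆
            {z | (Fin.init z : Fin k → ℝ) ∈ KZ.cube k ∧ 0 ≤ z (Fin.last k) ∧ z (Fin.last k) ≤ 1 + θ} →
          U.domain = KZ.cube (k + 1) → (U.integrand = fun _ => 1) →
          ∃ (m : ℕ) (K : KZ.IntegralRep (m + 1)), IsCompact K.domain ∧ (interior K.domain).Nonempty ∧
            (∀ x ∈ K.domain, K.integrand x = 1) ∧
            KZ.of (K.prod A) - KZ.of (K.prod U) ∈ KZ.relations) ∧
        (∀ (k m : ℕ) (A U : KZ.IntegralRep (k + 1)) (K : KZ.IntegralRep (m + 1)), IsCompact A.domain →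
          (interior A.domain).Nonempty → (∀ x ∈ A.domain, A.integrand x = 1) → A.value = 1 →
          {z | (Fin.init z : Fin k → ℝ) ∈ KZ.cube k ∧ 0 ≤ z (Fin.last k) ∧ z (Fin.last k) ≤ 1 - θ} ⊆
            A.domain →
          A.domain ⊆
            {z | (Fin.init z : Fin k → ℝ) ∈ KZ.cube k ∧ 0 ≤ z (Fin.last k) ∧ z (Fin.last k) ≤ 1 + θ} →
          U.domain = KZ.cube (k + 1) → (U.integrand = fun _ => 1) →
          IsCompact K.domain → (interior K.domain).Nonempty → (∀ x ∈ K.domain, K.integrand x = 1) →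
          {z | (Fin.init z : Fin m → ℝ) ∈ KZ.cube m ∧ 0 ≤ z (Fin.last m) ∧ z (Fin.last m) ≤ 1 - θ} ⊆
            K.domain →
          K.domain ⊆
            {z | (Fin.init z : Fin m → ℝ) ∈ KZ.cube m ∧ 0 ≤ z (Fin.last m) ∧ z (Fin.last m) ≤ 1 + θ} →
          KZ.of (K.prod A) - KZ.of (K.prod U) ∈ KZ.relations → KZ.of A - KZ.of U ∈ KZ.relations)) := by
  intro θ hθ0 hθ1
  rw [kernelForm_iff, weakKernel_iff_bumpStablyCube θ hθ0 hθ1,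
    cancellation_iff_bumpBodyCancellation θ hθ0 hθ1]

/-- **OctahedralSymmetry twin** of `kernelForm_iff_bump`. [folklore] -/
theorem octahedralSymmetry_kernelForm_iff_bump :
    ∀ θ : ℝ, 0 < θ → θ < 1 →
      (Summit.KontsevichZagierPeriods.KontsevichZagierPeriods.Theses.OctahedralSymmetry.KernelForm ↔
        (∀ (k : ℕ) (A U : KZ.IntegralRep (k + 1)), IsCompact A.domain → (interior A.domain).Nonempty →
          (∀ x ∈ A.domain, A.integrand x = 1) → A.value = 1 →
          {z | (Fin.init z : Fin k → ℝ) ∈ KZ.cube k ∧ 0 ≤ z (Fin.last k) ∧ z (Fin.last k) ≤ 1 - θ} ⊆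
            A.domain →
          A.domain ⊆
            {z | (Fin.init z : Fin k → ℝ) ∈ KZ.cube k ∧ 0 ≤ z (Fin.last k) ∧ z (Fin.last k) ≤ 1 + θ} →
          U.domain = KZ.cube (k + 1) → (U.integrand = fun _ => 1) →
          ∃ (m : ℕ) (K : KZ.IntegralRep (m + 1)), IsCompact K.domain ∧ (interior K.domain).Nonempty ∧
            (∀ x ∈ K.domain, K.integrand x = 1) ∧
            KZ.of (K.prod A) - KZ.of (K.prod U) ∈ KZ.relations) ∧
        (∀ (k m : ℕ) (A U : KZ.IntegralRep (k + 1)) (K : KZ.IntegralRep (m + 1)), IsCompact A.domain →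
          (interior A.domain).Nonempty → (∀ x ∈ A.domain, A.integrand x = 1) → A.value = 1 →
          {z | (Fin.init z : Fin k → ℝ) ∈ KZ.cube k ∧ 0 ≤ z (Fin.last k) ∧ z (Fin.last k) ≤ 1 - θ} ⊆
            A.domain →
          A.domain ⊆
            {z | (Fin.init z : Fin k → ℝ) ∈ KZ.cube k ∧ 0 ≤ z (Fin.last k) ∧ z (Fin.last k) ≤ 1 + θ} →
          U.domain = KZ.cube (k + 1) → (U.integrand = fun _ => 1) →
          IsCompact K.domain → (interior K.domain).Nonempty → (∀ x ∈ K.domain, K.integrand x = 1) →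
          {z | (Fin.init z : Fin m → ℝ) ∈ KZ.cube m ∧ 0 ≤ z (Fin.last m) ∧ z (Fin.last m) ≤ 1 - θ} ⊆
            K.domain →
          K.domain ⊆
            {z | (Fin.init z : Fin m → ℝ) ∈ KZ.cube m ∧ 0 ≤ z (Fin.last m) ∧ z (Fin.last m) ≤ 1 + θ} →
          KZ.of (K.prod A) - KZ.of (K.prod U) ∈ KZ.relations → KZ.of A - KZ.of U ∈ KZ.relations)) :=
  fun θ hθ0 hθ1 =>
    octahedralSymmetry_kernelForm_iff_vietaFibre_kernelForm.trans (kernelForm_iff_bump θ hθ0 hθ1)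

end Summit.KontsevichZagierPeriods.KernelForm.LocaliseAtValuePrime
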